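import Literature.NumberTheory.GaloisRepresentations.ArtinConductorWildProofs
import Literature.NumberTheory.GaloisRepresentations.ArtinConductorHerbrandProofs
import Literature.NumberTheory.GaloisRepresentations.InertiaLiftAbsoluteProofs
import Literature.NumberTheory.GaloisRepresentations.RamificationFiltrationProofs
import Literature.NumberTheory.GaloisRepresentations.RamificationFiltrationHerbrandProofs
import HarnessLib

/-!
# Tame quotients of the absolute inertia groups of a number field are cyclic

Topic `NumberTheory/GaloisRepresentations` (theorems only; no definitions, no named facts).  For a
number field `K`, a finite place `v`, a prime `𝔓 ∣ v` of `\bar ℤ_K = absIntegers (𝓞 K) K`, its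
inertia group `I_𝔓 ≤ Γ_K = Gal(K̄/K)` and its wild ramification groups `Γ_K^u(𝔓)`, `u > 0`
(`absUpperRamificationSubgroup`), and a continuous homomorphism `f : Γ_K → H` to a discrete group:

* `Literature.NumberTheory.GaloisRepresentations.isCyclic_map_inertia_of_forall_absUpperRamificationSubgroup`
  — **if `f` kills every `Γ_K^u(𝔓)`, `u > 0` (i.e. `f` is tamely ramified at `𝔓`), then `f(I_𝔓)`
  is cyclic**: the global twin of the local named fact `absInertia_map_isCyclic` (`TameInertia`,
  Serre, *Local Fields*, Ch. IV §2, Cor. 1 of Prop. 7: "`G_0/G_1` is cyclic").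
* `…exists_map_inertia_eq_zpowers_of_forall_absUpperRamificationSubgroup` — the same with an
  explicit generator `f s`, `s ∈ I_𝔓`;
* `…exists_apply_inertia_eq_apply_wild_mul_zpow` — without the tameness hypothesis: there are
  `s ∈ I_𝔓` and `u₀ > 0` with `f g ∈ f(Γ_K^{u₀}(𝔓)) · (f s)^ℤ` for every `g ∈ I_𝔓`
  ("`I_𝔓 = P_𝔓 · ⟨s⟩` in every finite quotient": the tame inertia group is pro-cyclic).

Proof (finite level, no local fields).  `f` factors through `Gal(E/K)` for a finite Galois `E/K ⊆ K̄`
(`exists_isGalois_ker_le`); at `𝔮 = 𝔓 ∩ E`, `I_𝔓` maps ONTO `G_0(𝔮)`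
(`inertia_comap_eq_map_absRestrictNormalHom`, Serre I §7 Prop. 22 (b)) and `Γ_K^u(𝔓)` maps onto
`Gal(E/K)^u(𝔮)` (Herbrand, `absUpperRamificationSubgroup_map_absRestrictNormalHom_holds`), which for
`u = φ_𝔮(1) > 0` is `G_{⌈ψ φ 1⌉} = G_1(𝔮)`; so the factored map kills `G_1(𝔮)`, and
`G_0(𝔮) = G_1(𝔮) · ⟨s⟩` (`exists_inertia_comap_eq_ramificationSubgroup_one_mul_zpowers`, the tree's
form of "`G_0/G_1 ↪ κ(𝔮)ˣ` is cyclic") gives `f(I_𝔓) = ⟨f s⟩`.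

## References

* [SerreLocalFields1979] J.-P. Serre, *Local Fields*, GTM 67, Ch. IV §2, Cor. 1 of Prop. 7; Ch. IV
  §3, Prop. 14 and Remark 1; Ch. I §7, Prop. 22 (b).
* [NeukirchANT1999] J. Neukirch, *Algebraic Number Theory*, Ch. II §9–§10.
-/

noncomputable section

open scoped NumberField Pointwise
open Field IsDedekindDomain

namespace Literature.NumberTheory.GaloisRepresentations

universe u

variable {K : Type u} [Field K] [NumberField K]

/-- **`I_𝔓 = P_𝔓 · ⟨s⟩` in every finite quotient** (the tame inertia group is pro-cyclic).  Let `K`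
be a number field, `𝔓 ∣ v` a prime of `\bar ℤ_K` and `f : Γ_K → H` a continuous homomorphism to a
discrete group.  Then there are `s ∈ I_𝔓` and `u₀ > 0` such that every `g ∈ I_𝔓` satisfies
`f g = f w · (f s)ᵏ` for some `k ∈ ℤ` and some `w` in the wild ramification group `Γ_K^{u₀}(𝔓)`.
(Finite level: `G_0(𝔮) = G_1(𝔮) · ⟨s̄⟩` at `𝔮 = 𝔓 ∩ E`, Serre IV §2 Cor. 1; `I_𝔓 ↠ G_0(𝔮)`,
Serre I §7 Prop. 22 (b); `Γ_K^{φ(1)}(𝔓) ↠ G_1(𝔮)`, Herbrand IV §3 Prop. 14.)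
[cite: SerreLocalFields1979, Ch. IV §2 Cor. 1 of Prop. 7, with Ch. IV §3 Prop. 14 and Ch. I §7 Prop. 22(b)] -/
theorem exists_apply_inertia_eq_apply_wild_mul_zpow
    {v : HeightOneSpectrum (𝓞 K)} {𝔓 : Ideal (absIntegers (𝓞 K) K)} (h𝔓 : 𝔓 ∈ v.primesAbove)
    {H : Type*} [Group H] [TopologicalSpace H] [DiscreteTopology H]
    (f : absoluteGaloisGroup K →ₜ* H) :
    ∃ s ∈ 𝔓.inertia (absoluteGaloisGroup K), ∃ u₀ : ℝ, 0 < u₀ ∧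
      ∀ g ∈ 𝔓.inertia (absoluteGaloisGroup K), ∃ (k : ℤ) (w : absoluteGaloisGroup K),
        w ∈ absUpperRamificationSubgroup (𝓞 K) 𝔓 u₀ ∧ f g = f w * f s ^ k := by
  classical
  haveI : 𝔓.IsPrime := h𝔓.1
  haveI : 𝔓.IsMaximal := HeightOneSpectrum.isMaximal_of_mem_primesAbove h𝔓
  -- `f` factors through a finite Galois `E/K`
  obtain ⟨E, hEfd, hEgal, hker⟩ := exists_isGalois_ker_le K f
  haveI := hEfd
  haveI := hEgal
  haveI : Algebra.IsSeparable K E := Algebra.IsSeparable.of_integral K E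
  set res : absoluteGaloisGroup K →* (E ≃ₐ[K] E) := absRestrictNormalHom E with hres
  have hsurj : Function.Surjective res :=
    (AlgEquiv.restrictNormalHom_surjective (F := K) (K₁ := E) (AlgebraicClosure K)).comp
      (absoluteGaloisGroup.toAlgEquiv K).surjective
  set fbar : (E ≃ₐ[K] E) →* H := MonoidHom.liftOfSurjective res hsurj ⟨f.toMonoidHom, hker⟩
    with hfbar
  have hfbar_apply : ∀ σ : absoluteGaloisGroup K, fbar (res σ) = f σ := fun σ ↦
    MonoidHom.liftOfRightInverse_comp_apply res _ _ ⟨f.toMonoidHom, hker⟩ σ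
  -- the prime `𝔮 = 𝔓 ∩ E`, its inertia group `G_0(𝔮) = I_𝔓|_E` and `G_1(𝔮) = Γ_K^{φ(1)}(𝔓)|_E`
  set 𝔮 := 𝔓.comap (E.integralClosureToAbsIntegers (𝓞 K)) with h𝔮
  have hinertia : 𝔮.inertia (E ≃ₐ[K] E) = (𝔓.inertia (absoluteGaloisGroup K)).map res :=
    inertia_comap_eq_map_absRestrictNormalHom 𝔓 E
  set u₀ : ℝ := herbrandPhi 𝔮 (E ≃ₐ[K] E) 1 with hu₀
  have hu₀pos : 0 < u₀ := herbrandPhi_pos 𝔮 (E ≃ₐ[K] E) one_pos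
  have hG1 : 𝔮.ramificationSubgroup (E ≃ₐ[K] E) 1 =
      (absUpperRamificationSubgroup (𝓞 K) 𝔓 u₀).map res := by
    rw [absUpperRamificationSubgroup_map_absRestrictNormalHom_holds h𝔓 E u₀]
    change _ = 𝔮.ramificationSubgroup (E ≃ₐ[K] E) ⌈herbrandPsi 𝔮 (E ≃ₐ[K] E) u₀⌉₊
    rw [hu₀, herbrandPsi_herbrandPhi_holds 𝔮 (E ≃ₐ[K] E) 1, Nat.ceil_one]
  -- `G_0(𝔮) = G_1(𝔮) · ⟨s̄⟩`
  haveI : Finite (𝓞 K ⧸ 𝔓.under (𝓞 K)) := by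
    rw [← h𝔓.2.over]
    exact Ideal.finiteQuotientOfFreeOfNeBot v.asIdeal v.ne_bot
  have h0 : 𝔓.under (𝓞 K) ≠ ⊥ := by
    rw [← h𝔓.2.over]
    exact v.ne_bot
  obtain ⟨sbar, hsbar, hgen⟩ :=
    GaloisRep.exists_inertia_comap_eq_ramificationSubgroup_one_mul_zpowers (𝓞 K) 𝔓 h0 E
  -- lift `s̄` to `s ∈ I_𝔓`
  have hsbar' : sbar ∈ (𝔓.inertia (absoluteGaloisGroup K)).map res := hinertia ▸ hsbar
  obtain ⟨s, hs, hres_s⟩ := hsbar'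
  refine ⟨s, hs, u₀, hu₀pos, fun g hg ↦ ?_⟩
  have hgbar : res g ∈ 𝔮.inertia (E ≃ₐ[K] E) := hinertia ▸ ⟨g, hg, rfl⟩
  obtain ⟨k, hk⟩ := hgen (res g) hgbar
  rw [hG1] at hk
  obtain ⟨w, hw, hres_w⟩ := hk
  refine ⟨k, w, hw, ?_⟩
  rw [← hfbar_apply, ← hfbar_apply, ← hfbar_apply, ← map_zpow, ← map_mul, hres_w, hres_s,
    inv_mul_cancel_right]

/-- **Tame quotients of `I_𝔓 ≤ Γ_K` are cyclic, with a generator.**  If moreover `f` kills every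
`Γ_K^u(𝔓)`, `u > 0` (i.e. `f` is tamely ramified at `𝔓`), then `f(I_𝔓) = ⟨f s⟩` for some `s ∈ I_𝔓`.
[cite: SerreLocalFields1979, Ch. IV §2 Cor. 1 of Prop. 7] -/
theorem exists_map_inertia_eq_zpowers_of_forall_absUpperRamificationSubgroup
    {v : HeightOneSpectrum (𝓞 K)} {𝔓 : Ideal (absIntegers (𝓞 K) K)} (h𝔓 : 𝔓 ∈ v.primesAbove)
    {H : Type*} [Group H] [TopologicalSpace H] [DiscreteTopology H]
    (f : absoluteGaloisGroup K →ₜ* H)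
    (hf : ∀ u : ℝ, 0 < u → ∀ σ ∈ absUpperRamificationSubgroup (𝓞 K) 𝔓 u, f σ = 1) :
    ∃ s ∈ 𝔓.inertia (absoluteGaloisGroup K),
      (𝔓.inertia (absoluteGaloisGroup K)).map f.toMonoidHom = Subgroup.zpowers (f s) := by
  obtain ⟨s, hs, u₀, hu₀, h⟩ := exists_apply_inertia_eq_apply_wild_mul_zpow h𝔓 f
  refine ⟨s, hs, le_antisymm ?_ ?_⟩
  · rintro _ ⟨g, hg, rfl⟩
    obtain ⟨k, w, hw, hgw⟩ := h g hg
    change f g ∈ _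
    rw [hgw, hf u₀ hu₀ w hw, one_mul]
    exact Subgroup.zpow_mem_zpowers _ _
  · rw [Subgroup.zpowers_le]
    exact ⟨s, hs, rfl⟩

/-- **Tame quotients of the absolute inertia groups of a number field are cyclic** (the global twin
of `absInertia_map_isCyclic`): for a continuous homomorphism `f : Γ_K → H` to a discrete group
killing every wild ramification group `Γ_K^u(𝔓)`, `u > 0`, the image `f(I_𝔓)` of the inertia group
is cyclic.  Serre: "`G_0/G_1` is cyclic" (the tame inertia group `I_𝔓/P_𝔓 ≅ ∏_{ℓ ≠ p} ℤ_ℓ(1)` is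
pro-cyclic).  [cite: SerreLocalFields1979, Ch. IV §2 Cor. 1 of Prop. 7] -/
theorem isCyclic_map_inertia_of_forall_absUpperRamificationSubgroup
    {v : HeightOneSpectrum (𝓞 K)} {𝔓 : Ideal (absIntegers (𝓞 K) K)} (h𝔓 : 𝔓 ∈ v.primesAbove)
    {H : Type*} [Group H] [TopologicalSpace H] [DiscreteTopology H]
    (f : absoluteGaloisGroup K →ₜ* H)
    (hf : ∀ u : ℝ, 0 < u → ∀ σ ∈ absUpperRamificationSubgroup (𝓞 K) 𝔓 u, f σ = 1) :
    IsCyclic ((𝔓.inertia (absoluteGaloisGroup K)).map f.toMonoidHom) := by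
  obtain ⟨s, -, h⟩ := exists_map_inertia_eq_zpowers_of_forall_absUpperRamificationSubgroup h𝔓 f hf
  rw [h]
  infer_instance

/-- **Product form** (the shape in which "the tame inertia group has a unique quadratic character" is
used): if `f₁ : Γ_K → H₁` and `f₂ : Γ_K → H₂` are continuous homomorphisms to discrete groups both
killing every `Γ_K^u(𝔓)`, `u > 0`, then the image of `I_𝔓` under `(f₁, f₂) : Γ_K → H₁ × H₂` is cyclic
(the theorem applied to the product map).  [cite: SerreLocalFields1979, Ch. IV §2 Cor. 1 of Prop. 7] -/
theorem isCyclic_map_inertia_prod_of_forall_absUpperRamificationSubgroup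
    {v : HeightOneSpectrum (𝓞 K)} {𝔓 : Ideal (absIntegers (𝓞 K) K)} (h𝔓 : 𝔓 ∈ v.primesAbove)
    {H₁ H₂ : Type*} [Group H₁] [TopologicalSpace H₁] [DiscreteTopology H₁]
    [Group H₂] [TopologicalSpace H₂] [DiscreteTopology H₂]
    (f₁ : absoluteGaloisGroup K →ₜ* H₁) (f₂ : absoluteGaloisGroup K →ₜ* H₂)
    (hf₁ : ∀ u : ℝ, 0 < u → ∀ σ ∈ absUpperRamificationSubgroup (𝓞 K) 𝔓 u, f₁ σ = 1)
    (hf₂ : ∀ u : ℝ, 0 < u → ∀ σ ∈ absUpperRamificationSubgroup (𝓞 K) 𝔓 u, f₂ σ = 1) :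
    IsCyclic ((𝔓.inertia (absoluteGaloisGroup K)).map (f₁.prod f₂).toMonoidHom) :=
  isCyclic_map_inertia_of_forall_absUpperRamificationSubgroup h𝔓 (f₁.prod f₂) fun u hu σ hσ ↦
    Prod.ext (hf₁ u hu σ hσ) (hf₂ u hu σ hσ)

end Literature.NumberTheory.GaloisRepresentations

end
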